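import Mathlib
import Summits.Ventures.PercRepro2.Defs
import Summits.Ventures.PercRepro2.Graph
import Summits.Ventures.PercRepro2.OneColourSwitch
import Summits.Ventures.PercRepro2.RegionHubSign
import Summits.Ventures.PercRepro2.SideSwitch
import Summits.Ventures.PercRepro2.SideSwitchFibre
import Summits.Ventures.PercRepro2.SideSwitchComps
import Summits.Ventures.PercRepro2.M9NoPocketDefs
import Summits.Ventures.PercRepro2.M9NoPocketWorld
import Summits.Ventures.PercRepro2.M9NoPocketWorldD
import Summits.Ventures.PercRepro2.M9NoPocketLegal
import Summits.Ventures.PercRepro2.M9NoPocketMono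
import Summits.Ventures.PercRepro2.M9NoPocketCompl
import Summits.Ventures.PercRepro2.M9NoPocketFibre
import Summits.Ventures.PercRepro2.M9NoPocketFreeBlock
import Summits.Ventures.PercRepro2.M9NoPocketFreeBlockK
import Summits.Ventures.PercRepro2.M9ReachedK
import Summits.Ventures.PercRepro2.M9QuadHarrisPow
import Summits.Ventures.PercRepro2.M9UnitAlgebra
import Summits.Ventures.PercRepro2.M9NoPocketSameType
import Summits.Ventures.PercRepro2.M9NoPocketDeadPattern
import Summits.Ventures.PercRepro2.M9NoPocketLinkCompl
import Summits.Ventures.PercRepro2.M9NoPocketLinkE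
import Summits.Ventures.PercRepro2.M9NoPocketSigmaRS
import Summits.Ventures.PercRepro2.M9NoPocketUnitE
import Summits.Ventures.PercRepro2.M9NoPocketUnitK
import Summits.Ventures.PercRepro2.M9NoPocketUnitK2
import Summits.Ventures.PercRepro2.M9NoPocketUnitSum

/-!
# THEOREM RK-NP: `reachedKSum ≤ 0` on the no-pocket class (blind cell PercRepro2, p3 g36,
2026-08-29; `proofs/P3-NPHDR.md` §5, kernel)

For a finite marked multigraph, marks `p, q, r, s` and a non-mark `d` with `NoPocketAt`
(every neighbour of `d` other than `r, s` is adjacent to `r` or `s`), no edge `d`–`r`, `d`–`s`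
(`T`-free), no loop at `d` and no `r`–`s` edge, **the `K`-reached sum `Σ_{Sep ∧ DOne ∧ d ∈ K₂}
σ_pq σ_rs` is non-positive** (`reachedKSum_nonpos_of_noPocket`) — conjecture (RK) of the
lane, row 2′RK, on the whole no-pocket class.  Proof: the fibration over the representatives
(`M9NoPocketFibre`), the representatives as the dead patterns of the same-type ones
(`M9NoPocketSameType`), the doubling by the outside flip, and **the unit inequality**
(`unit_reached_nonpos`): the unit of a same-type representative and its outside flip has
reached sum `EX + Σ_{D ≠ A} K(D)` (`M9NoPocketUnitSum`), `EX = 2·Σ (1 − ℓ S)(HY S − HW (𝔑∖S))`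
(`M9NoPocketUnitE`), `K(D) ≤ ℓK D·(HY ∅ − HW 𝔑)` (`M9NoPocketUnitK2`), the linking patterns
outnumber the linking joined sets, and the quad inequality of `M9QuadHarrisPow` closes with
`ℓ` monotone with `ℓ ∅ = 0` (`link_empty_eq_zero`), `HW` monotone and `HY ≤ HW`
(`M9NoPocketMono`).  Corollary: `dSignSum ≤ 0` once more (`M9ReachedK`).  Own work; std
axioms.
-/

namespace Summit.Ventures.PercRepro2

namespace NoPocket

open Finset Classical RegionHub OneColourSwitch SideSwitch M9Reduce

variable {V : Type*} {E : Type*}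

section Abstract

variable {β : Type*} [Fintype β] [DecidableEq β]

/-- The quad inequality with `HY ≤ HW` required on the subsets of `N` only. -/
theorem quad_sum_nonpos_powerset' (N : Finset β) {ℓ HY HW : Finset β → ℤ}
    (hℓ : ∀ S ⊆ N, ∀ T ⊆ N, S ⊆ T → ℓ S ≤ ℓ T) (hℓ0 : ∀ S, 0 ≤ ℓ S)
    (hℓ1 : ∀ S, ℓ S ≤ 1) (hℓe : ℓ ∅ = 0)
    (hW : ∀ S ⊆ N, ∀ T ⊆ N, S ⊆ T → HW S ≤ HW T) (hYW : ∀ S ⊆ N, HY S ≤ HW S) {N₁ : ℤ}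
    (hN₁ : ∑ S ∈ N.powerset.filter (fun S => S ≠ ∅), ℓ S ≤ N₁) :
    2 * (∑ S ∈ N.powerset.filter (fun S => S ≠ ∅ ∧ S ≠ N),
        (1 - ℓ S) * (HY S - HW (N \ S))) + N₁ * (HY ∅ - HW N) ≤ 0 := by
  have h := quad_sum_nonpos_powerset N hℓ hℓ0 hℓ1 hℓe hW
    (HY := fun S => if S ⊆ N then HY S else HW S)
    (fun S => by
      by_cases hS : S ⊆ N
      · simp only [hS, if_true]; exact hYW S hS
      · simp only [hS, if_false]; exact le_rfl) hN₁
  rw [if_pos (Finset.empty_subset N)] at h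
  have hc : ∑ S ∈ N.powerset.filter (fun S => S ≠ ∅ ∧ S ≠ N),
      (1 - ℓ S) * ((if S ⊆ N then HY S else HW S) - HW (N \ S)) =
      ∑ S ∈ N.powerset.filter (fun S => S ≠ ∅ ∧ S ≠ N), (1 - ℓ S) * (HY S - HW (N \ S)) :=
    Finset.sum_congr rfl (fun S hS => by rw [if_pos (mem_properOf.1 hS).1])
  rw [hc] at h
  exact h

end Abstract

section Unit

variable [Fintype V] [DecidableEq V] [Fintype E] [DecidableEq E] {ends : E → Sym2 V}

/-- With every block switched (and no `r`–`s` edge), `r` and `s` are not `Y`-linked. -/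
lemma not_conn_rs_all_switched {p q r s d : V} (hnp : NoPocketAt ends d r s) (hr : d ≠ r)
    (hs : d ≠ s) (hT : Tset ends d r s = ∅) (hrs : ∀ e, ends e ≠ s(r, s)) (hrs' : r ≠ s)
    {ρ₀ : Config E} (hρ₀ : ρ₀ ∈ RepD ends p q r s d) (hst : ∀ e, d ∈ ends e → ρ₀ e = true) :
    ¬ Conn ends (assignX ends (blocks ends d r s ρ₀, ∅) ρ₀) r s := by
  intro hc
  have hX : blocks ends d r s ρ₀ ⊆ blocks ends d r s ρ₀ := Finset.Subset.refl _
  have hF : ((blocks ends d r s ρ₀, ∅) : Finset (Finset V) × Finset E).2 ⊆ Tset ends d r s :=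
    Finset.empty_subset _
  -- the `Y`-world is `{r, s}`
  have hK : ∀ v ∈ K2 ends r s (assignX ends (blocks ends d r s ρ₀, ∅) ρ₀), v = r ∨ v = s := by
    intro v hv
    rw [K2_assignX hnp hρ₀ hX hF hr hs (fun _ C _ => not_hasW_of_sameType hst C)] at hv
    rcases hv with hv | ⟨_, hsrc⟩
    · rw [K2_endsD_assignX hρ₀ hX hF] at hv
      obtain ⟨hvK, hvX⟩ := hv
      rcases mem_A0_of_mem_K2_endsD hvK with h | h | h
      · exact Or.inl h
      · exact Or.inr h
      · exfalso
        apply hvX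
        show v ∈ (↑(unionT (comps (endsD ends d) r s ρ₀)) : Set V)
        rw [unionT_comps]
        exact Finset.mem_coe.2 h
    · exfalso
      rcases hsrc with ⟨e, he, _⟩ | ⟨C, hC, hCX, _⟩
      · rw [hT] at he
        exact Finset.notMem_empty e he
      · exact hCX hC
  have key : s ∈ {z | z = r} := by
    refine mem_of_conn_of_closed (ends := ends) (ω := assignX ends (blocks ends d r s ρ₀, ∅) ρ₀)
      ?_ rfl hc
    rintro z hz v hadj
    have hzr : z = r := hz
    obtain ⟨_, e, he, hends⟩ := openGraph_adj.1 hadj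
    rw [hzr] at hends
    have hvK : v ∈ K2 ends r s (assignX ends (blocks ends d r s ρ₀, ∅) ρ₀) :=
      mem_K2_of_open (r_mem_K2 r s _) he hends
    rcases hK v hvK with hvr | hvs
    · exact hvr
    · rw [hvs] at hends
      exact absurd hends (hrs e)
  exact hrs' key.symm

/-- **The unit inequality**: the reached sums of a same-type representative and of its outside
flip add up to a non-positive number. -/
theorem unit_reached_nonpos {p q r s d : V} (hnp : NoPocketAt ends d r s) (hpd : p ≠ d)
    (hqd : q ≠ d) (hr : d ≠ r) (hs : d ≠ s) (hT : Tset ends d r s = ∅)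
    (hloop : ∀ e, ends e ≠ s(d, d)) (hrs : ∀ e, ends e ≠ s(r, s)) (hrs' : r ≠ s)
    {ρ₀ : Config E} (hρ₀ : ρ₀ ∈ RepD ends p q r s d) (hst : ∀ e, d ∈ ends e → ρ₀ e = true) :
    (∑ D ∈ (univ.filter (fun e => d ∈ ends e)).powerset, ∑ x ∈ L4 ends d r s (flipF D ρ₀),
      (if d ∈ K2 ends r s (assignX ends x (flipF D ρ₀)) then
        sigma ends (assignX ends x (flipF D ρ₀)) p q * sigma ends (assignX ends x (flipF D ρ₀)) r s
      else 0)) +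
    (∑ D ∈ (univ.filter (fun e => d ∈ ends e)).powerset,
      ∑ x ∈ L4 ends d r s (flipF D (flipOp ends d r s ρ₀)),
      (if d ∈ K2 ends r s (assignX ends x (flipF D (flipOp ends d r s ρ₀))) then
        sigma ends (assignX ends x (flipF D (flipOp ends d r s ρ₀))) p q *
          sigma ends (assignX ends x (flipF D (flipOp ends d r s ρ₀))) r s
      else 0)) ≤ 0 := by
  have hρ₁ := flipOp_mem_RepD hr hs hρ₀
  have hst₁ := sameType_flipOp hnp hr hs hT hloop hρ₀ hst
  by_cases hA : univ.filter (fun e => d ∈ ends e) = ∅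
  · -- no edge at `d`: nothing is reached
    rw [hA, Finset.powerset_empty, Finset.sum_singleton, Finset.sum_singleton, ← hA,
      inner_all_dead_eq_zero hnp hr hs hT hρ₀ hst, inner_all_dead_eq_zero hnp hr hs hT hρ₁ hst₁]
    exact le_rfl
  -- the sets of `ρ₀`
  obtain ⟨𝔉, h𝔉⟩ : ∃ 𝔉 : Finset (Finset V),
      𝔉 = (blocks ends d r s ρ₀).filter (fun C => ¬ hasY ends d ρ₀ C) := ⟨_, rfl⟩
  obtain ⟨𝔑, h𝔑⟩ : ∃ 𝔑 : Finset (Finset V),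
      𝔑 = (blocks ends d r s ρ₀).filter (hasY ends d ρ₀) := ⟨_, rfl⟩
  have h𝔉₁ : 𝔉 = (blocks ends d r s (flipOp ends d r s ρ₀)).filter
      (fun C => ¬ hasY ends d (flipOp ends d r s ρ₀) C) := by
    rw [filter_free_flipOp hr hs]; exact h𝔉
  have h𝔑₁ : 𝔑 = (blocks ends d r s (flipOp ends d r s ρ₀)).filter
      (hasY ends d (flipOp ends d r s ρ₀)) := by
    rw [filter_joined_flipOp hr hs]; exact h𝔑
  have h𝔉b : 𝔉 ⊆ blocks ends d r s ρ₀ := by rw [h𝔉]; exact Finset.filter_subset _ _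
  have h𝔑b : 𝔑 ⊆ blocks ends d r s ρ₀ := by rw [h𝔑]; exact Finset.filter_subset _ _
  have hLf : 𝔉.filter (LinksIn ends ρ₀ r s) ⊆ 𝔉 := Finset.filter_subset _ _
  -- the two unit sums
  rw [sum_inner_eq hnp hr hs hT hloop hρ₀ hst hA h𝔉 h𝔑,
    sum_inner_eq hnp hr hs hT hloop hρ₁ hst₁ hA h𝔉₁ h𝔑₁]
  -- the doubly-reached part
  have hE := EX_add_EX_eq hnp hr hs hT hloop hrs hρ₀ hst h𝔉 h𝔑 (p := p) (q := q)
  -- `[p ~_Y q]` is monotone in the switched block set, for both representatives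
  have hy0 : ∀ X X' : Finset (Finset V), X ⊆ X' → X' ⊆ blocks ends d r s ρ₀ →
      (if Conn ends (assignX ends (X, ∅) ρ₀) p q then (1 : ℤ) else 0) ≤
        (if Conn ends (assignX ends (X', ∅) ρ₀) p q then 1 else 0) := by
    intro X X' hXX' hX'
    exact ite_le_ite_of_imp (conn_pq_assignX_mono hnp hpd hqd hr hs hρ₀
      (Prod.le_def.2 ⟨hXX', le_rfl⟩) ((mem_L4_sameType_iff hT hst).2 ⟨hXX'.trans hX', rfl⟩)
      ((mem_L4_sameType_iff hT hst).2 ⟨hX', rfl⟩))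
  have hy1 : ∀ X X' : Finset (Finset V), X ⊆ X' → X' ⊆ blocks ends d r s ρ₀ →
      (if Conn ends (assignX ends (X, ∅) (flipOp ends d r s ρ₀)) p q then (1 : ℤ) else 0) ≤
        (if Conn ends (assignX ends (X', ∅) (flipOp ends d r s ρ₀)) p q then 1 else 0) := by
    intro X X' hXX' hX'
    have hX'' : X' ⊆ blocks ends d r s (flipOp ends d r s ρ₀) := by
      rw [blocks_flipOp hr hs]; exact hX'
    exact ite_le_ite_of_imp (conn_pq_assignX_mono hnp hpd hqd hr hs hρ₁
      (Prod.le_def.2 ⟨hXX', le_rfl⟩) ((mem_L4_sameType_iff hT hst₁).2 ⟨hXX'.trans hX'', rfl⟩)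
      ((mem_L4_sameType_iff hT hst₁).2 ⟨hX'', rfl⟩))
  -- `HW` is monotone on the joined subsets
  have hW : ∀ S ⊆ 𝔑, ∀ S' ⊆ 𝔑, S ⊆ S' →
      (∑ T ∈ 𝔉.powerset.filter (fun T => 𝔉.filter (LinksIn ends ρ₀ r s) ⊆ T),
          ((if Conn ends (assignX ends (T ∪ S, ∅) ρ₀) p q then (1 : ℤ) else 0) +
            (if Conn ends (assignX ends (T ∪ S, ∅) (flipOp ends d r s ρ₀)) p q
              then 1 else 0))) ≤
        (∑ T ∈ 𝔉.powerset.filter (fun T => 𝔉.filter (LinksIn ends ρ₀ r s) ⊆ T),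
          ((if Conn ends (assignX ends (T ∪ S', ∅) ρ₀) p q then (1 : ℤ) else 0) +
            (if Conn ends (assignX ends (T ∪ S', ∅) (flipOp ends d r s ρ₀)) p q
              then 1 else 0))) := by
    intro S hS S' hS' hSS'
    refine Finset.sum_le_sum (fun T hTp => ?_)
    have hTf : T ⊆ 𝔉 := Finset.mem_powerset.1 (Finset.mem_filter.1 hTp).1
    have hsub : T ∪ S ⊆ T ∪ S' := Finset.union_subset_union_right hSS'
    have hb : T ∪ S' ⊆ blocks ends d r s ρ₀ :=
      Finset.union_subset (hTf.trans h𝔉b) (hS'.trans h𝔑b)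
    exact add_le_add (hy0 _ _ hsub hb) (hy1 _ _ hsub hb)
  -- `HY ≤ HW` on the joined subsets
  have hYW : ∀ S ⊆ 𝔑,
      (∑ T ∈ 𝔉.powerset.filter (fun T => T ∩ 𝔉.filter (LinksIn ends ρ₀ r s) = ∅),
          ((if Conn ends (assignX ends (T ∪ S, ∅) ρ₀) p q then (1 : ℤ) else 0) +
            (if Conn ends (assignX ends (T ∪ S, ∅) (flipOp ends d r s ρ₀)) p q
              then 1 else 0))) ≤
        (∑ T ∈ 𝔉.powerset.filter (fun T => 𝔉.filter (LinksIn ends ρ₀ r s) ⊆ T),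
          ((if Conn ends (assignX ends (T ∪ S, ∅) ρ₀) p q then (1 : ℤ) else 0) +
            (if Conn ends (assignX ends (T ∪ S, ∅) (flipOp ends d r s ρ₀)) p q
              then 1 else 0))) := by
    intro S hS
    rw [← sum_filter_inter_empty_eq_sum_union hLf (fun T =>
      (if Conn ends (assignX ends (T ∪ S, ∅) ρ₀) p q then (1 : ℤ) else 0) +
        (if Conn ends (assignX ends (T ∪ S, ∅) (flipOp ends d r s ρ₀)) p q then 1 else 0))]
    refine Finset.sum_le_sum (fun T hTp => ?_)
    have hTf : T ⊆ 𝔉 := Finset.mem_powerset.1 (Finset.mem_filter.1 hTp).1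
    have hsub : T ∪ S ⊆ T ∪ 𝔉.filter (LinksIn ends ρ₀ r s) ∪ S :=
      Finset.union_subset_union_left Finset.subset_union_left
    have hb : T ∪ 𝔉.filter (LinksIn ends ρ₀ r s) ∪ S ⊆ blocks ends d r s ρ₀ :=
      Finset.union_subset (Finset.union_subset (hTf.trans h𝔉b) (hLf.trans h𝔉b)) (hS.trans h𝔑b)
    exact add_le_add (hy0 _ _ hsub hb) (hy1 _ _ hsub hb)
  -- the link indicator: monotone, `0 ≤ ℓ ≤ 1`, `ℓ ∅ = 0`
  have hℓ : ∀ S ⊆ 𝔑, ∀ S' ⊆ 𝔑, S ⊆ S' →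
      (if Conn ends (assignX ends (𝔉 ∪ (𝔑 \ S), ∅) ρ₀) r s then (1 : ℤ) else 0) ≤
        (if Conn ends (assignX ends (𝔉 ∪ (𝔑 \ S'), ∅) ρ₀) r s then 1 else 0) := by
    intro S _ S' _ hSS'
    have hx : (𝔉 ∪ (𝔑 \ S'), (∅ : Finset E)) ∈ L4 ends d r s ρ₀ :=
      (mem_L4_sameType_iff hT hst).2
        ⟨Finset.union_subset h𝔉b (Finset.sdiff_subset.trans h𝔑b), rfl⟩
    have hx' : (𝔉 ∪ (𝔑 \ S), (∅ : Finset E)) ∈ L4 ends d r s ρ₀ :=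
      (mem_L4_sameType_iff hT hst).2
        ⟨Finset.union_subset h𝔉b (Finset.sdiff_subset.trans h𝔑b), rfl⟩
    exact ite_le_ite_of_imp (conn_rs_assignX_anti hnp hpd hqd hr hs hρ₀
      (Prod.le_def.2 ⟨Finset.union_subset_union_right
        (Finset.sdiff_subset_sdiff (Finset.Subset.refl _) hSS'), le_rfl⟩) hx hx')
  have hℓ0 : ∀ S : Finset (Finset V),
      (0 : ℤ) ≤ (if Conn ends (assignX ends (𝔉 ∪ (𝔑 \ S), ∅) ρ₀) r s then 1 else 0) := by
    intro S; split_ifs <;> norm_num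
  have hℓ1 : ∀ S : Finset (Finset V),
      (if Conn ends (assignX ends (𝔉 ∪ (𝔑 \ S), ∅) ρ₀) r s then (1 : ℤ) else 0) ≤ 1 := by
    intro S; split_ifs <;> norm_num
  have hℓe : (if Conn ends (assignX ends (𝔉 ∪ (𝔑 \ ∅), ∅) ρ₀) r s then (1 : ℤ) else 0) = 0 := by
    rw [Finset.sdiff_empty, h𝔉, h𝔑, free_union_joined,
      if_neg (not_conn_rs_all_switched hnp hr hs hT hrs hrs' hρ₀ hst)]
  -- the count of the linking patterns
  have hN₁ := sum_link_le_sum_linkK hnp hr hs hT hloop hρ₀ hst h𝔉 h𝔑 (p := p) (q := q)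
  -- the one-sided part
  have hK : (∑ D ∈ (univ.filter (fun e => d ∈ ends e)).powerset.filter
        (fun D => D ≠ univ.filter (fun e => d ∈ ends e)),
        ∑ T ∈ 𝔉.powerset, sigma ends (assignX ends (T, ∅) (flipF D ρ₀)) p q *
          sigma ends (assignX ends (T, ∅) (flipF D ρ₀)) r s) +
      (∑ D ∈ (univ.filter (fun e => d ∈ ends e)).powerset.filter
        (fun D => D ≠ univ.filter (fun e => d ∈ ends e)),
        ∑ T ∈ 𝔉.powerset, sigma ends (assignX ends (T, ∅) (flipF D (flipOp ends d r s ρ₀))) p q *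
          sigma ends (assignX ends (T, ∅) (flipF D (flipOp ends d r s ρ₀))) r s) ≤
      (∑ D ∈ (univ.filter (fun e => d ∈ ends e)).powerset.filter
        (fun D => D ≠ univ.filter (fun e => d ∈ ends e)),
        (if Conn ends (assignX ends (𝔉, ∅) (flipF D ρ₀)) r s then (1 : ℤ) else 0)) *
      ((∑ T ∈ 𝔉.powerset.filter (fun T => T ∩ 𝔉.filter (LinksIn ends ρ₀ r s) = ∅),
          ((if Conn ends (assignX ends (T ∪ ∅, ∅) ρ₀) p q then (1 : ℤ) else 0) +
            (if Conn ends (assignX ends (T ∪ ∅, ∅) (flipOp ends d r s ρ₀)) p q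
              then 1 else 0))) -
        (∑ T ∈ 𝔉.powerset.filter (fun T => 𝔉.filter (LinksIn ends ρ₀ r s) ⊆ T),
          ((if Conn ends (assignX ends (T ∪ 𝔑, ∅) ρ₀) p q then (1 : ℤ) else 0) +
            (if Conn ends (assignX ends (T ∪ 𝔑, ∅) (flipOp ends d r s ρ₀)) p q
              then 1 else 0)))) := by
    rw [← Finset.sum_add_distrib, Finset.sum_mul]
    refine Finset.sum_le_sum (fun D hD => ?_)
    obtain ⟨hDp, hDA⟩ := Finset.mem_filter.1 hD
    exact K_add_K_le hnp hpd hqd hr hs hT hloop hrs hrs' hρ₀ hst (Finset.mem_powerset.1 hDp) hDA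
      h𝔉 h𝔑 rfl (hYW ∅ (Finset.empty_subset _))
  -- the quad inequality
  have hquad := quad_sum_nonpos_powerset' 𝔑
    (ℓ := fun S => if Conn ends (assignX ends (𝔉 ∪ (𝔑 \ S), ∅) ρ₀) r s then (1 : ℤ) else 0)
    (HY := fun S => ∑ T ∈ 𝔉.powerset.filter (fun T => T ∩ 𝔉.filter (LinksIn ends ρ₀ r s) = ∅),
      ((if Conn ends (assignX ends (T ∪ S, ∅) ρ₀) p q then (1 : ℤ) else 0) +
        (if Conn ends (assignX ends (T ∪ S, ∅) (flipOp ends d r s ρ₀)) p q then 1 else 0)))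
    (HW := fun S => ∑ T ∈ 𝔉.powerset.filter (fun T => 𝔉.filter (LinksIn ends ρ₀ r s) ⊆ T),
      ((if Conn ends (assignX ends (T ∪ S, ∅) ρ₀) p q then (1 : ℤ) else 0) +
        (if Conn ends (assignX ends (T ∪ S, ∅) (flipOp ends d r s ρ₀)) p q then 1 else 0)))
    hℓ hℓ0 hℓ1 hℓe hW hYW hN₁
  beta_reduce at hquad
  linarith [hE, hK, hquad]

end Unit

section Theorem

variable [Fintype V] [DecidableEq V] [Fintype E] [DecidableEq E] {ends : E → Sym2 V}

omit [Fintype V] [DecidableEq V] [Fintype E] [DecidableEq E] in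
/-- `σ_rr = 0`. -/
lemma sigma_self (ω : Config E) (r : V) : sigma ends ω r r = 0 := by
  simp [sigma, conn_refl]

/-- The `K`-reached sum as a sum over the fibration. -/
theorem reachedKSum_eq_sum_repD {p q r s d : V} (hnp : NoPocketAt ends d r s) (hpd : p ≠ d)
    (hqd : q ≠ d) (hr : d ≠ r) (hs : d ≠ s) :
    reachedKSum ends p q r s d = ∑ ρ ∈ RepD ends p q r s d, ∑ x ∈ L4 ends d r s ρ,
      (if d ∈ K2 ends r s (assignX ends x ρ) then
        sigma ends (assignX ends x ρ) p q * sigma ends (assignX ends x ρ) r s else 0) := by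
  refine Eq.trans ?_ (sum_dOne_eq_sum_repD_L4 hnp hpd hqd hr hs
    (fun ω => if d ∈ K2 ends r s ω then sigma ends ω p q * sigma ends ω r s else 0))
  unfold reachedKSum DOneSet
  rw [Finset.sum_filter]
  refine Finset.sum_congr rfl (fun ω _ => ?_)
  by_cases h1 : sep2 ends p q r s ω <;> by_cases h2 : DOne ends r s d ω <;>
    by_cases h3 : d ∈ K2 ends r s ω <;> simp [h1, h2, h3]

/-- **THEOREM RK-NP.**  On the class `{NoPocketAt d, T-free, no loop at d, no r–s edge}` the
`K`-reached sum `Σ_{Sep ∧ DOne ∧ d ∈ K₂} σ_pq σ_rs` is non-positive. -/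
theorem reachedKSum_nonpos_of_noPocket {p q r s d : V} (hnp : NoPocketAt ends d r s)
    (hpd : p ≠ d) (hqd : q ≠ d) (hr : d ≠ r) (hs : d ≠ s) (hT : Tset ends d r s = ∅)
    (hloop : ∀ e, ends e ≠ s(d, d)) (hrs : ∀ e, ends e ≠ s(r, s)) :
    reachedKSum ends p q r s d ≤ 0 := by
  by_cases hrs' : r = s
  · -- `σ_rs = 0` throughout
    subst hrs'
    unfold reachedKSum
    refine le_of_eq (Finset.sum_eq_zero (fun ω _ => ?_))
    rw [sigma_self, mul_zero]
    split_ifs <;> rfl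
  rw [reachedKSum_eq_sum_repD hnp hpd hqd hr hs, sum_repD_eq_sum_sameType_powerset hT]
  -- doubling by the outside flip
  have hdouble : ∑ ρ₀ ∈ (RepD ends p q r s d).filter (fun ρ => ∀ e, d ∈ ends e → ρ e = true),
      ∑ D ∈ (univ.filter (fun e => d ∈ ends e)).powerset, ∑ x ∈ L4 ends d r s (flipF D ρ₀),
        (if d ∈ K2 ends r s (assignX ends x (flipF D ρ₀)) then
          sigma ends (assignX ends x (flipF D ρ₀)) p q *
            sigma ends (assignX ends x (flipF D ρ₀)) r s else 0) =
      ∑ ρ₀ ∈ (RepD ends p q r s d).filter (fun ρ => ∀ e, d ∈ ends e → ρ e = true),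
      ∑ D ∈ (univ.filter (fun e => d ∈ ends e)).powerset,
        ∑ x ∈ L4 ends d r s (flipF D (flipOp ends d r s ρ₀)),
        (if d ∈ K2 ends r s (assignX ends x (flipF D (flipOp ends d r s ρ₀))) then
          sigma ends (assignX ends x (flipF D (flipOp ends d r s ρ₀))) p q *
            sigma ends (assignX ends x (flipF D (flipOp ends d r s ρ₀))) r s else 0) := by
    refine Finset.sum_nbij' (flipOp ends d r s) (flipOp ends d r s)
      (fun ρ hρ => flipOp_sameType hnp hr hs hT hloop hρ)
      (fun ρ hρ => flipOp_sameType hnp hr hs hT hloop hρ)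
      (fun ρ _ => flipOp_flipOp hr hs ρ) (fun ρ _ => flipOp_flipOp hr hs ρ) (fun ρ _ => ?_)
    rw [flipOp_flipOp hr hs]
  have hle : ∑ ρ₀ ∈ (RepD ends p q r s d).filter (fun ρ => ∀ e, d ∈ ends e → ρ e = true),
      ((∑ D ∈ (univ.filter (fun e => d ∈ ends e)).powerset, ∑ x ∈ L4 ends d r s (flipF D ρ₀),
        (if d ∈ K2 ends r s (assignX ends x (flipF D ρ₀)) then
          sigma ends (assignX ends x (flipF D ρ₀)) p q *
            sigma ends (assignX ends x (flipF D ρ₀)) r s else 0)) +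
      (∑ D ∈ (univ.filter (fun e => d ∈ ends e)).powerset,
        ∑ x ∈ L4 ends d r s (flipF D (flipOp ends d r s ρ₀)),
        (if d ∈ K2 ends r s (assignX ends x (flipF D (flipOp ends d r s ρ₀))) then
          sigma ends (assignX ends x (flipF D (flipOp ends d r s ρ₀))) p q *
            sigma ends (assignX ends x (flipF D (flipOp ends d r s ρ₀))) r s else 0))) ≤ 0 := by
    refine Finset.sum_nonpos (fun ρ₀ hρ₀ => ?_)
    obtain ⟨hρ, hst⟩ := Finset.mem_filter.1 hρ₀
    exact unit_reached_nonpos hnp hpd hqd hr hs hT hloop hrs hrs' hρ hst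
  rw [Finset.sum_add_distrib, ← hdouble] at hle
  linarith

/-- **Corollary**: the single-`d` sign sum is non-positive on the class (through
`dSignSum = N + reachedKSum + kOnly` of `M9ReachedK`). -/
theorem dSignSum_nonpos_of_noPocket_rk {p q r s d : V} (hnp : NoPocketAt ends d r s)
    (hpd : p ≠ d) (hqd : q ≠ d) (hr : d ≠ r) (hs : d ≠ s) (hT : Tset ends d r s = ∅)
    (hloop : ∀ e, ends e ≠ s(d, d)) (hrs : ∀ e, ends e ≠ s(r, s)) :
    dSignSum ends p q r s d ≤ 0 :=
  dSignSum_nonpos_of_reachedK_nonpos hr hs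
    (reachedKSum_nonpos_of_noPocket hnp hpd hqd hr hs hT hloop hrs)

end Theorem

end NoPocket

end Summit.Ventures.PercRepro2
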